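import Summits.QuantumFields.BalabanUV.Beta.GAN24.SlotDefectWindowShapes
import Summits.QuantumFields.BalabanUV.Beta.GAN24.SlotDefectWindowLegs

/-!
# `BalabanUV.Beta.GAN24.SlotDefectWindowLegShapes` — binder row G-an2-4 ∕ (CONV-C), CT-W, route of record «WC-TL»; ι-WIN PART 7 (journal INTENT [LEAF02-G53-ONLINE]):
# **A DECAY LETTER ON A LEG DIVERGENCE TRANSFERS TO THE ONE-LEG DRESSING DEFECT — `LocStencil₂` COROLLARIES FOR T-DL's `D_{L₁}`, `D_{L₂}`**
# (constant `2(d+1)N · (2N+1)^{d+1} · e^{δ(d+1)N} · C`, same rate; multiplier rows∕columns are `0` and cost nothing)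

NOT IN PRINT; OUR BOOKKEEPING (G-an2-4 crux team (2), leaf prover `b2b-balaban-gan24-formalise-leaf-02`, gen 53).  [folklore] one recentring over the window on top of PART 4's
single-leg window bounds; the leg-divergence letters are DISPLAYED INLINE as hypotheses — they are what (Q-L) («QL-LL», RULING R-gan24p1-g25-1 (iii), OPEN) is to deliver for
`Y = T̃_j`; nothing of (Q-L) is proved here.  Generic `d + 1`, in-block root, `1 ≤ N`, `0 ≤ δ`; 0 `def`, 0 cited facts, 0 `def … : Prop`, 0 sorry.
HONEST FRAMING (cell contract, verbatim): «discharging `BetaPertH` makes Bałaban's UV stability UNCONDITIONAL — a real constructive-QFT result; it is NOT the continuum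
limit and NOT the Clay problem.»  HONEST DEPENDENCY (verbatim): «continuum YM on T⁴ ⇐ BetaPertH ∧ nine spine estimates (0/9 proved); BetaPertH ⇐ (D1) ∧ (D4) ∧ CAP+tail;
G-an2-4 gates asym, D1 and NE2/3/4.»  Discharges NOTHING of (Q-D) ∕ (H) ∕ (Q-R) ∕ (Q-L) ∕ «T2Shape» ∕ «T2Drift» ∕ (hW, hWall); NEVER «G-an2-4 closed» as (CONV-C); NOT D1,
NOT `BetaPertH`, NOT continuum, NOT Clay.
-/

noncomputable section

open Finset
open scoped BigOperators
open Literature.MathematicalPhysics.QuantumFieldTheory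
open Literature.MathematicalPhysics.QuantumFieldTheory.Balaban1983to89
open Literature.MathematicalPhysics.QuantumFieldTheory.Balaban1983to89.Beta
open B12Sec2to5 (l1 l1_nonneg)
open ExpKernelCalculus (MKer Site)
open AffineAveraging (Form0 Form1 box toSite unitVec)
open OneStepResolventKernel (Fib)
open BalabanCompositeJets (LocStencil₂)
open Summit.QuantumFields.BalabanUV.Beta.AxialDressingRooted (cube legCo₁BmAt legCo₂BmAt)
open Summit.QuantumFields.BalabanUV.Beta.GAN24.BiStencilZeroMode (Tab)
open Summit.QuantumFields.BalabanUV.Beta.GAN24.SlotDefectWindowBound (two_mul_nonneg)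
open Summit.QuantumFields.BalabanUV.Beta.GAN24.SlotDefectWindowShapes (exp_window_recenter_le' sum_cube_const)
open Summit.QuantumFields.BalabanUV.Beta.GAN24.SlotDefectWindowLegs (abs_legDefect₁_inl_le legDefect₁_inr abs_legDefect₂_inl_le legDefect₂_inr)

namespace Summit.QuantumFields.BalabanUV.Beta.GAN24.SlotDefectWindowLegShapes

variable {d N : ℕ} {r : Fin (d + 1) → ℕ}

/-- NOT IN PRINT; OUR BOOKKEEPING.  **A FIRST-LEG DIVERGENCE LETTER GIVES A `LocStencil₂` `D_{L₁}`** (in-block root, `1 ≤ N`, `0 ≤ δ`; the letter is a HYPOTHESIS):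
if `|Σ_β (Y κ u κ′ u′ p z (inl β) b − Y κ u κ′ u′ (p − e_β) z (inl β) b)| ≤ C·e^{−δ|u′ − u|₁}·e^{−δ(|p − u|₁ + |z − u|₁)}` for all `κ u κ′ u′ p z b`, then
`LocStencil₂ (L₁ Y − Y) (2(d+1)N · (2N+1)^{d+1} · e^{δ(d+1)N} · C) δ`, `L₁ Y := κ u κ′ u′ ↦ legCo₁BmAt ρ N (Y κ u κ′ u′)`. -/
theorem locStencil₂_legDefect₁_of_div (hN : 1 ≤ N) (hr : r ∈ box (d + 1) N) (Y : Tab d) {C δ : ℝ} (hδ : 0 ≤ δ)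
    (hL : ∀ (κ : Fin (d + 1)) (u : Fin (d + 1) → ℤ) (κ' : Fin (d + 1)) (u' p z : Fin (d + 1) → ℤ) (b : Fib d),
      |∑ β : Fin (d + 1), (Y κ u κ' u' p z (Sum.inl β) b - Y κ u κ' u' (p - unitVec β) z (Sum.inl β) b)|
        ≤ C * Real.exp (-δ * l1 (u' - u)) * Real.exp (-δ * (l1 (p - u) + l1 (z - u)))) :
    LocStencil₂ ((fun κ u κ' u' => legCo₁BmAt (toSite r) N (Y κ u κ' u')) - Y)
      (2 * ((d : ℝ) + 1) * N * ((((2 * N + 1) ^ (d + 1) : ℕ) : ℝ) * (Real.exp (δ * (((d : ℝ) + 1) * N)) * C))) δ := by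
  have hC : 0 ≤ C := by
    have h := hL 0 0 0 0 0 0 (Sum.inl 0)
    have hpos : 0 < Real.exp (-δ * l1 ((0 : Fin (d + 1) → ℤ) - 0)) * Real.exp (-δ * (l1 ((0 : Fin (d + 1) → ℤ) - 0) + l1 ((0 : Fin (d + 1) → ℤ) - 0))) :=
      mul_pos (Real.exp_pos _) (Real.exp_pos _)
    have h' : 0 ≤ C * (Real.exp (-δ * l1 ((0 : Fin (d + 1) → ℤ) - 0)) * Real.exp (-δ * (l1 ((0 : Fin (d + 1) → ℤ) - 0) + l1 ((0 : Fin (d + 1) → ℤ) - 0)))) := by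
      rw [← mul_assoc]; exact (abs_nonneg _).trans h
    exact nonneg_of_mul_nonneg_left h' hpos
  intro κ u κ' u' x z a b
  set E : ℝ := Real.exp (δ * (((d : ℝ) + 1) * N)) with hE
  have hK : 0 ≤ 2 * ((d : ℝ) + 1) * N * ((((2 * N + 1) ^ (d + 1) : ℕ) : ℝ) * (E * C)) * Real.exp (-δ * l1 (u' - u))
      * Real.exp (-δ * (l1 (x - u) + l1 (z - u))) := by
    have : 0 ≤ ((((2 * N + 1) ^ (d + 1) : ℕ) : ℝ) * (E * C)) := mul_nonneg (Nat.cast_nonneg _) (mul_nonneg (Real.exp_pos _).le hC)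
    exact mul_nonneg (mul_nonneg (mul_nonneg (two_mul_nonneg d N) this) (Real.exp_pos _).le) (Real.exp_pos _).le
  rcases a with α | m
  · -- field row: the window bound, each term recentred at `u`
    have hterm : ∀ v ∈ cube (d + 1) N,
        |∑ β : Fin (d + 1), (Y κ u κ' u' (x + v) z (Sum.inl β) b - Y κ u κ' u' (x + v - unitVec β) z (Sum.inl β) b)|
          ≤ E * C * (Real.exp (-δ * l1 (u' - u)) * Real.exp (-δ * (l1 (x - u) + l1 (z - u)))) := by
      intro v hv
      have h := hL κ u κ' u' (x + v) z b
      have r := exp_window_recenter_le' hv hδ x u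
      have split : Real.exp (-δ * (l1 ((x + v) - u) + l1 (z - u))) = Real.exp (-δ * l1 ((x + v) - u)) * Real.exp (-δ * l1 (z - u)) := by
        rw [← Real.exp_add]; congr 1; ring
      have split' : Real.exp (-δ * (l1 (x - u) + l1 (z - u))) = Real.exp (-δ * l1 (x - u)) * Real.exp (-δ * l1 (z - u)) := by
        rw [← Real.exp_add]; congr 1; ring
      rw [split] at h
      rw [split']
      calc |∑ β : Fin (d + 1), (Y κ u κ' u' (x + v) z (Sum.inl β) b - Y κ u κ' u' (x + v - unitVec β) z (Sum.inl β) b)|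
          ≤ C * Real.exp (-δ * l1 (u' - u)) * (Real.exp (-δ * l1 ((x + v) - u)) * Real.exp (-δ * l1 (z - u))) := h
        _ ≤ C * Real.exp (-δ * l1 (u' - u)) * ((E * Real.exp (-δ * l1 (x - u))) * Real.exp (-δ * l1 (z - u))) :=
            mul_le_mul_of_nonneg_left (mul_le_mul_of_nonneg_right r (Real.exp_pos _).le) (mul_nonneg hC (Real.exp_pos _).le)
        _ = E * C * (Real.exp (-δ * l1 (u' - u)) * (Real.exp (-δ * l1 (x - u)) * Real.exp (-δ * l1 (z - u)))) := by ring
    have h1 := abs_legDefect₁_inl_le hN hr Y κ u κ' u' x z α b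
    refine h1.trans ?_
    calc 2 * ((d : ℝ) + 1) * N * ∑ v ∈ cube (d + 1) N,
          |∑ β : Fin (d + 1), (Y κ u κ' u' (x + v) z (Sum.inl β) b - Y κ u κ' u' (x + v - unitVec β) z (Sum.inl β) b)|
        ≤ 2 * ((d : ℝ) + 1) * N * ∑ _v ∈ cube (d + 1) N, E * C * (Real.exp (-δ * l1 (u' - u)) * Real.exp (-δ * (l1 (x - u) + l1 (z - u)))) :=
          mul_le_mul_of_nonneg_left (Finset.sum_le_sum hterm) (two_mul_nonneg d N)
      _ = _ := by rw [sum_cube_const]; ring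
  · -- multiplier row: the defect vanishes
    rw [legDefect₁_inr, abs_zero]
    exact hK

/-- NOT IN PRINT; OUR BOOKKEEPING.  **A SECOND-LEG DIVERGENCE LETTER GIVES A `LocStencil₂` `D_{L₂}`** (in-block root, `1 ≤ N`, `0 ≤ δ`; the letter is a HYPOTHESIS):
if `|Σ_β (Y κ u κ′ u′ x p a (inl β) − Y κ u κ′ u′ x (p − e_β) a (inl β))| ≤ C·e^{−δ|u′ − u|₁}·e^{−δ(|x − u|₁ + |p − u|₁)}` for all `κ u κ′ u′ x p a`, then
`LocStencil₂ (L₂ Y − Y) (2(d+1)N · (2N+1)^{d+1} · e^{δ(d+1)N} · C) δ`, `L₂ Y := κ u κ′ u′ ↦ legCo₂BmAt ρ N (Y κ u κ′ u′)`. -/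
theorem locStencil₂_legDefect₂_of_div (hN : 1 ≤ N) (hr : r ∈ box (d + 1) N) (Y : Tab d) {C δ : ℝ} (hδ : 0 ≤ δ)
    (hL : ∀ (κ : Fin (d + 1)) (u : Fin (d + 1) → ℤ) (κ' : Fin (d + 1)) (u' x p : Fin (d + 1) → ℤ) (a : Fib d),
      |∑ β : Fin (d + 1), (Y κ u κ' u' x p a (Sum.inl β) - Y κ u κ' u' x (p - unitVec β) a (Sum.inl β))|
        ≤ C * Real.exp (-δ * l1 (u' - u)) * Real.exp (-δ * (l1 (x - u) + l1 (p - u)))) :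
    LocStencil₂ ((fun κ u κ' u' => legCo₂BmAt (toSite r) N (Y κ u κ' u')) - Y)
      (2 * ((d : ℝ) + 1) * N * ((((2 * N + 1) ^ (d + 1) : ℕ) : ℝ) * (Real.exp (δ * (((d : ℝ) + 1) * N)) * C))) δ := by
  have hC : 0 ≤ C := by
    have h := hL 0 0 0 0 0 0 (Sum.inl 0)
    have hpos : 0 < Real.exp (-δ * l1 ((0 : Fin (d + 1) → ℤ) - 0)) * Real.exp (-δ * (l1 ((0 : Fin (d + 1) → ℤ) - 0) + l1 ((0 : Fin (d + 1) → ℤ) - 0))) :=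
      mul_pos (Real.exp_pos _) (Real.exp_pos _)
    have h' : 0 ≤ C * (Real.exp (-δ * l1 ((0 : Fin (d + 1) → ℤ) - 0)) * Real.exp (-δ * (l1 ((0 : Fin (d + 1) → ℤ) - 0) + l1 ((0 : Fin (d + 1) → ℤ) - 0)))) := by
      rw [← mul_assoc]; exact (abs_nonneg _).trans h
    exact nonneg_of_mul_nonneg_left h' hpos
  intro κ u κ' u' x z a b
  set E : ℝ := Real.exp (δ * (((d : ℝ) + 1) * N)) with hE
  have hK : 0 ≤ 2 * ((d : ℝ) + 1) * N * ((((2 * N + 1) ^ (d + 1) : ℕ) : ℝ) * (E * C)) * Real.exp (-δ * l1 (u' - u))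
      * Real.exp (-δ * (l1 (x - u) + l1 (z - u))) := by
    have : 0 ≤ ((((2 * N + 1) ^ (d + 1) : ℕ) : ℝ) * (E * C)) := mul_nonneg (Nat.cast_nonneg _) (mul_nonneg (Real.exp_pos _).le hC)
    exact mul_nonneg (mul_nonneg (mul_nonneg (two_mul_nonneg d N) this) (Real.exp_pos _).le) (Real.exp_pos _).le
  rcases b with β₀ | m
  · have hterm : ∀ v ∈ cube (d + 1) N,
        |∑ β : Fin (d + 1), (Y κ u κ' u' x (z + v) a (Sum.inl β) - Y κ u κ' u' x (z + v - unitVec β) a (Sum.inl β))|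
          ≤ E * C * (Real.exp (-δ * l1 (u' - u)) * Real.exp (-δ * (l1 (x - u) + l1 (z - u)))) := by
      intro v hv
      have h := hL κ u κ' u' x (z + v) a
      have r := exp_window_recenter_le' hv hδ z u
      have split : Real.exp (-δ * (l1 (x - u) + l1 ((z + v) - u))) = Real.exp (-δ * l1 (x - u)) * Real.exp (-δ * l1 ((z + v) - u)) := by
        rw [← Real.exp_add]; congr 1; ring
      have split' : Real.exp (-δ * (l1 (x - u) + l1 (z - u))) = Real.exp (-δ * l1 (x - u)) * Real.exp (-δ * l1 (z - u)) := by
        rw [← Real.exp_add]; congr 1; ring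
      rw [split] at h
      rw [split']
      calc |∑ β : Fin (d + 1), (Y κ u κ' u' x (z + v) a (Sum.inl β) - Y κ u κ' u' x (z + v - unitVec β) a (Sum.inl β))|
          ≤ C * Real.exp (-δ * l1 (u' - u)) * (Real.exp (-δ * l1 (x - u)) * Real.exp (-δ * l1 ((z + v) - u))) := h
        _ ≤ C * Real.exp (-δ * l1 (u' - u)) * (Real.exp (-δ * l1 (x - u)) * (E * Real.exp (-δ * l1 (z - u)))) :=
            mul_le_mul_of_nonneg_left (mul_le_mul_of_nonneg_left r (Real.exp_pos _).le) (mul_nonneg hC (Real.exp_pos _).le)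
        _ = E * C * (Real.exp (-δ * l1 (u' - u)) * (Real.exp (-δ * l1 (x - u)) * Real.exp (-δ * l1 (z - u)))) := by ring
    have h1 := abs_legDefect₂_inl_le hN hr Y κ u κ' u' x z a β₀
    refine h1.trans ?_
    calc 2 * ((d : ℝ) + 1) * N * ∑ v ∈ cube (d + 1) N,
          |∑ β : Fin (d + 1), (Y κ u κ' u' x (z + v) a (Sum.inl β) - Y κ u κ' u' x (z + v - unitVec β) a (Sum.inl β))|
        ≤ 2 * ((d : ℝ) + 1) * N * ∑ _v ∈ cube (d + 1) N, E * C * (Real.exp (-δ * l1 (u' - u)) * Real.exp (-δ * (l1 (x - u) + l1 (z - u)))) :=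
          mul_le_mul_of_nonneg_left (Finset.sum_le_sum hterm) (two_mul_nonneg d N)
      _ = _ := by rw [sum_cube_const]; ring
  · rw [legDefect₂_inr, abs_zero]
    exact hK

end Summit.QuantumFields.BalabanUV.Beta.GAN24.SlotDefectWindowLegShapes

end
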